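import Summits.Ventures.HodgeRepro2.T6HostHodge
import Summits.Ventures.HodgeRepro2.T6HostCoeff

/-!
# T6HostCoeffNatural — the coefficient map `ℂ ⊗ H^k(X(ℂ), ℚ) → H^k(X(ℂ), ℂ)` is natural in the lead's shape

Cell pub-hodge-repro2, Tier 6 (README §10), seat t6-p2; the lead's ask STATUS l. 11045 (3): the lead's
`T6HostHodge.CoeffNatural coeffC` (naturality of a coefficient map under the pull-backs `pullQ f k` / `pull f k`
along morphisms of schemes over `ℂ`), for THIS seat's `HostCoeff.coeffC` (T6HostCoeff: the `ℂ`-linear extension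
of the cochain-level change of coefficients `φ ↦ algebraMap ℚ ℂ ∘ φ`), instantiated at the complex points
`ComplexPoints X`:
* `coeffNatural : CoeffNatural (fun X k => HostCoeff.coeffC (ComplexPoints X) k)` — by `ℂ`-linearity on the pure
  tensors `c ⊗ x = c • (1 ⊗ x)` and `HostCoeff.map_coeffC_one_tmul` (naturality on `1 ⊗ x` along the continuous
  map `AlgPoints.mapContinuous f` of complex points).
No display, no `sorry`; standard axioms. §8(d): uses an L-value-free non-vanishing device: NO.
-/

noncomputable section

namespace Summit.Ventures.HodgeRepro2.T6.HostCoeff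

open CategoryTheory
open scoped TensorProduct
open HostAPI.Carriers.AlgebraicGeometry.Motives HostAPI.Carriers.AlgebraicTopology.SingularHomology
open Summit.Ventures.HodgeRepro2.T6.Host

/-- a pure tensor is the scalar multiple of the rational point: `c ⊗ x = c • (1 ⊗ x)` -/
theorem smul_one_tmul {M : Type*} [AddCommGroup M] [Module ℚ M] (c : ℂ) (x : M) :
    c ⊗ₜ[ℚ] x = c • ((1 : ℂ) ⊗ₜ[ℚ] x) := by
  rw [TensorProduct.smul_tmul', smul_eq_mul, mul_one]

/-- **NATURALITY OF `coeffC` UNDER PULL-BACKS** (the lead's `CoeffNatural`, STATUS l. 11045 (3)): for a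
morphism `f : X ⟶ Y` of schemes over `ℂ`, `coeffC ∘ (f^* ⊗ 1) = f^* ∘ coeffC` on `ℂ ⊗ H^k(Y(ℂ), ℚ)`. -/
theorem coeffNatural : CoeffNatural (fun X k => coeffC (ComplexPoints X) k) := by
  intro X Y f k w
  induction w using TensorProduct.induction_on with
  | zero => simp
  | tmul c x =>
    rw [smul_one_tmul, map_smul, map_smul, map_smul, map_smul, LinearMap.baseChange_tmul]
    congr 1
    exact (map_coeffC_one_tmul k (AlgPoints.mapContinuous (L := ℂ) f) x).symm
  | add w₁ w₂ h₁ h₂ => rw [map_add, map_add, map_add, map_add, h₁, h₂]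

end Summit.Ventures.HodgeRepro2.T6.HostCoeff

end
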